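import Literature.NumberTheory.EllipticCurves.IsogenyIdProofs
import Summits.BirchSwinnertonDyer.Rank1Residual.O6.X3KatoMemberBoundExactCount
import Literature.NumberTheory.EllipticCurves.IwasawaEulerCharProofs
import HarnessLib

/-!
# O6 / X3: the SHARP hull readings (kmc's exact member count M3♯ `KatoHull.ExactCountReading`),
# existentially closed over the FREE interface predicate, are EXACTLY AS STRONG AS the `2t` member bound
# — tightness theorem no. 2 for the node `O6.KatoMemberShaBoundOfReducible` / crux `ReducibleKatoMember`
# (cell `bsd-potss`, seat `bsd-potss-rkm` generation 2; sibling of `X3KatoMemberBoundReadingsTight.lean`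
# (p427116) and of kmc's `X3KatoMemberBoundExactCount(Upper).lean`; theorems only, nothing asserted)

HONEST FRAMING. Nothing about Kato's objects is asserted and the crux `ReducibleKatoMember` (item
stmt-BirchSwinnertonDyer-19196) is NOT closed; BSD is not advanced. kmc g7 sharpened the member count to
an EQUALITY (Reading M3♯, `KatoHull.ExactCountReading`: `ord Ш + v Tam + ord [A:y] = ord q + e +
ord #H²(ℤ[1/p],T) + 2t`) and derived the upper half on every reducible additive potentially-good rank-0
row from {M1, M2, M3♯} (`O6.x3PotGoodRankZeroUpper_of_hullReadingsSharp`, p419681). This file proves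
that, existentially closed over the free predicate `IsHullOf`, the sharp set {`MemberRealizable`,
`DivisibilityReading`, `ExactCountReading`} is EQUIVALENT to the `2t` MEMBER BOUND
  M₂ : «… ⟹ ∃ W' ∼ W, ord_p #Ш(W')[p^∞] + v_p Tam(W') ≤ ord_p q + 2·ord_p #tors(W')»
(= BSD_p's own bookkeeping `#Ш = q·#tors²/Tam` read as an inequality at some member; `M₂ ⟹ M` since
`2t ≤ 3t`, `of_two`). `⟸` (`two_of_hullReadingsSharp`) is kmc's argument with the exact count; `⟹`
(`exists_hullReadingsSharp_of_two`) uses the datum `exists_hullDatum_yIndex_eq_pow` — `H = F = Λ`,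
`z = y = p^a`, `𝐇² = 0`, `A = Λ_Γ`, so `[A : y] = #(Λ/(p^a, X)) = p^a`
(`IwasawaAlgebra.natCard_quotient_span_sup_span_X`) — with `a :=` the defect `(ord q + 2t) − (ord Ш + v Tam)`
of the member, over the tautological predicate "the conclusions of M2/M3♯ hold for `(W, D)`".

READING (for the planner / tribunal): like the plain readings (p427116), the sharp readings carry no
content beyond their conclusion until `IsHullOf` is PINNED (zeta class by its values — p425804 +
the layer bridge p427779 + `Kato2004.IwasawaH1Data.existsUnique_lift_of_isEulerSystem`; `𝐇²` by
(14.14.1) + divisibility); in particular the index `[A : y]` of the interface can be prescribed at will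
(`exists_hullDatum_yIndex_eq_pow`), so no reading that only CONSTRAINS `[A : y]`, `e`, `#𝐇²/X𝐇²`
against `Ш` can be a citation-grade input on its own.

Contents: `exists_hullDatum_yIndex_eq_pow` · `two_of_hullReadingsSharp` · `exists_hullReadingsSharp_of_two` ·
`two_iff_exists_hullReadingsSharp` · `of_two`. Pure kernel algebra; no Literature fact used or minted.

References: K. Kato, Astérisque 295 (2004) Thm. 12.4–12.6, §14.14, Prop. 14.16 (2) [Kato2004Asterisque];
C. Wuthrich, Doc. Math. 19 (2014) Lemma 11, 12, 14 [Wuthrich2014] — the printed inputs behind the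
readings; nothing about them is proved here.
-/

set_option autoImplicit false

noncomputable section

open scoped Classical

namespace Summit.BirchSwinnertonDyer.Rank1Residual

open WeierstrassCurve Literature.NumberTheory.EllipticCurves
  Literature.NumberTheory.EllipticCurves.IwasawaAlgebra Additive

namespace O6.KatoMemberShaBoundOfReducible

/-- **A hull datum with `[A : y] = p^a`** (and `𝐇² = 0`, `e = 0`): `H = F = Λ`, `j = id`,
`z = y = p^a`, `A = Λ_Γ`. So the index `[A : y]` of the interface can be prescribed freely. [folklore] -/
theorem exists_hullDatum_yIndex_eq_pow (p : ℕ) [Fact p.Prime] (a : ℕ) :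
    ∃ D : KatoHullDescentDatum p,
      D.HullDivisibility ∧ Finite (coinvariants p D.H2) ∧ D.yIndex = p ^ a ∧ D.h2Card = 1 ∧
        D.e = 0 := by
  have hp := (Fact.out : p.Prime)
  set c : IwasawaAlgebra p := PowerSeries.C ((p : ℤ_[p]) ^ a) with hc
  have hc0 : c ≠ 0 := by
    rw [hc]
    exact (map_ne_zero_iff _ (PowerSeries.C_injective)).mpr (pow_ne_zero _ (by exact_mod_cast hp.ne_zero))
  -- the index computation `#(Λ_Γ / (c)) = p^a`
  have hcard : Nat.card (coinvariants p (IwasawaAlgebra p) ⧸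
      (IwasawaAlgebra p) ∙ (Submodule.Quotient.mk c : coinvariants p (IwasawaAlgebra p))) = p ^ a := by
    have hS : (Ideal.span {(PowerSeries.X : IwasawaAlgebra p)} • (⊤ : Submodule (IwasawaAlgebra p)
        (IwasawaAlgebra p))) = Ideal.span {(PowerSeries.X : IwasawaAlgebra p)} := by
      rw [Ideal.smul_eq_mul, Ideal.mul_top]
    have hmap : (IwasawaAlgebra p) ∙ (Submodule.Quotient.mk c : coinvariants p (IwasawaAlgebra p)) =
        Submodule.map (Ideal.span {(PowerSeries.X : IwasawaAlgebra p)} • (⊤ : Submodule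
          (IwasawaAlgebra p) (IwasawaAlgebra p))).mkQ (Submodule.span (IwasawaAlgebra p) {c}) := by
      rw [Submodule.map_span, Set.image_singleton, Submodule.mkQ_apply]
    rw [hmap]
    rw [Nat.card_congr (Submodule.quotientQuotientEquivQuotientSup _ _).toEquiv, hS, sup_comm]
    change Nat.card (IwasawaAlgebra p ⧸ (Ideal.span {c} ⊔ Ideal.span {(PowerSeries.X : IwasawaAlgebra p)})) = p ^ a
    rw [natCard_quotient_span_sup_span_X (p := p) c (by rw [hc, PowerSeries.constantCoeff_C]; exact pow_ne_zero _ (by exact_mod_cast hp.ne_zero))]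
    rw [hc, PowerSeries.constantCoeff_C, ← mul_one ((p : ℤ_[p]) ^ a), PadicInt.valuation_p_pow_mul _ _ one_ne_zero,
      PadicInt.valuation_one, add_zero]
  refine ⟨{ H := IwasawaAlgebra p
            F := IwasawaAlgebra p
            j := LinearMap.id
            j_injective := fun _ _ h => h
            finite_coker := by
              rw [LinearMap.range_id]
              haveI : Subsingleton (IwasawaAlgebra p ⧸ (⊤ : Submodule (IwasawaAlgebra p)
                  (IwasawaAlgebra p))) := Submodule.Quotient.subsingleton_iff.mpr rfl
              infer_instance
            z := c
            z_ne_zero := hc0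
            isTorsion_quotient := by
              intro x
              induction x using Submodule.Quotient.induction_on with
              | H r =>
                refine ⟨⟨c, mem_nonZeroDivisors_of_ne_zero hc0⟩, ?_⟩
                rw [Submonoid.mk_smul, ← Submodule.Quotient.mk_smul, Submodule.Quotient.mk_eq_zero]
                exact Submodule.mem_span_singleton.mpr ⟨r, by rw [smul_eq_mul, smul_eq_mul, mul_comm]⟩
            y := c
            e := 0
            j_y := by simp
            H2 := Fin 0 → IwasawaAlgebra p
            isTorsion_H2 := fun x => ⟨1, by rw [Subsingleton.elim x 0, smul_zero]⟩
            A := coinvariants p (IwasawaAlgebra p)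
            ι := LinearMap.id
            π := 0
            ι_injective := fun _ _ h => h
            π_surjective := fun y => ⟨0, Subsingleton.elim _ _⟩
            exact_ι_π := fun y => ⟨fun _ => ⟨y, rfl⟩, fun _ => Subsingleton.elim _ _⟩ },
    ?_, ?_, ?_, ?_, rfl⟩
  · intro 𝔮 _
    have h0 : Module.lengthAt (IwasawaAlgebra p) (Fin 0 → IwasawaAlgebra p) 𝔮 = 0 :=
      Module.lengthAt_eq_zero_of_subsingleton (R := IwasawaAlgebra p)
        (M := Fin 0 → IwasawaAlgebra p) 𝔮
    change Module.lengthAt (IwasawaAlgebra p) (Fin 0 → IwasawaAlgebra p) 𝔮 ≤ _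
    simp only [h0, _root_.zero_le]
  · change Finite ((Fin 0 → IwasawaAlgebra p) ⧸ _)
    infer_instance
  · unfold KatoHullDescentDatum.yIndex
    change Nat.card (coinvariants p (IwasawaAlgebra p) ⧸
      (IwasawaAlgebra p) ∙ (LinearMap.id (Submodule.Quotient.mk c) :
        coinvariants p (IwasawaAlgebra p))) = p ^ a
    rw [LinearMap.id_apply]
    exact hcard
  · unfold KatoHullDescentDatum.h2Card
    change Nat.card ((Fin 0 → IwasawaAlgebra p) ⧸ _) = 1
    exact Nat.card_of_subsingleton 0

/-- **The SHARP readings give the `2t` member bound** (kmc's exact count M3♯ + the hull descent):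
`ord_p #Ш(W') + v_p Tam(W') ≤ ord_p q + 2·ord_p #tors(W')` at Kato's member — i.e. the BSD_p-exact upper
half at a member (T-X3K's "3t" was a reading artefact, kmc memo v6). Same transport as part 12.
[folklore] -/
theorem two_of_hullReadingsSharp
    {IsHullOf : ∀ (W : WeierstrassCurve ℚ) [W.IsElliptic] [W.IsGloballyMinimal] (p : ℕ)
      [Fact p.Prime], KatoHullDescentDatum p → Prop}
    (hM : KatoHull.MemberRealizable IsHullOf) (hD : KatoHull.DivisibilityReading IsHullOf)
    (hC : KatoHull.ExactCountReading IsHullOf) :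
    (∀ (W : WeierstrassCurve ℚ) [W.IsElliptic] [W.IsGloballyMinimal] (p : ℕ) [Fact p.Prime],
        p ≠ 2 → ¬ W.HasGoodReductionAtPrime p → ¬ W.HasMultiplicativeReductionAtPrime p →
        0 ≤ padicValRat p W.j → ¬ W.HasIrreducibleModPGaloisRep p →
        W.entireLFunction 1 ≠ 0 → Finite W.sha →
        ∃ (W' : WeierstrassCurve ℚ) (_ : W'.IsElliptic) (_ : W'.IsGloballyMinimal),
          IsIsogenous W W' ∧ Finite W'.sha ∧
          ∃ q : ℚ, W'.entireLFunction 1 / (W'.realPeriodRat : ℂ) = (q : ℂ) ∧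
            (padicValNat p (Nat.card (AddCommGroup.primaryComponent W'.sha p)) : ℤ) +
                padicValNat p W'.tamagawaProduct ≤
              padicValRat p q + 2 * (padicValNat p W'.torsionOrder : ℤ)) := by
  intro W _ _ p _ hp hng hnm hj hred hL hfin
  obtain ⟨W', hE', hM', hiso, D, hDof⟩ := hM W p hp ⟨hng, hnm⟩ hj hred
  obtain ⟨hadd', hj'⟩ := Addv.of_isIsogenous_of_padicValRat_j_nonneg (p := p) ⟨hng, hnm⟩ hj hiso
  have hred' : ¬ W'.HasIrreducibleModPGaloisRep p :=
    (X2.red_iff_of_isIsogenous (p := p) hiso).mp hred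
  have hL' : W'.entireLFunction 1 ≠ 0 := by
    rwa [← entireLFunction_eq_of_isIsogenous' hiso]
  have hfin' : Finite W'.sha := (IsIsogenous.shaFinite_iff_shaFinite hiso).mp hfin
  obtain ⟨hfin2, hne, q, hq, hcount⟩ := hC W' p D hp hadd' hj' hL' hfin' hDof
  have hdiv : D.HullDivisibility := hD W' p D hp hadd' hj' hred' hDof
  have hhull : D.e + padicValNat p D.h2Card ≤ padicValNat p D.yIndex :=
    D.le_padicValNat_yIndex hdiv hfin2 hne
  refine ⟨W', hE', hM', hiso, hfin', q, hq, ?_⟩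
  have hhull' : (D.e : ℤ) + (padicValNat p D.h2Card : ℤ) ≤ (padicValNat p D.yIndex : ℤ) := by
    exact_mod_cast hhull
  linarith

/-- **`2t` member bound ⟹ the SHARP readings over SOME interface predicate.** Define "`D` is a hull
datum of `W`" as: hull divisibility, `𝐇²/X𝐇²` finite, `[A : y] ≠ 0`, and — if `L(W,1) ≠ 0` and `Ш(W)` is
finite — the EXACT count `ord Ш + v Tam + ord [A:y] = ord q + e + ord #(𝐇²/X𝐇²) + 2t`. M2 and M3♯ hold
by definition; M1 is witnessed by the member `W'` of the hypothesis carrying the datum with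
`[A : y] = p^a`, `a :=` the defect `(ord q + 2t) − (ord Ш + v Tam) ≥ 0` (`exists_hullDatum_yIndex_eq_pow`).
[folklore] -/
theorem exists_hullReadingsSharp_of_two (hK : (∀ (W : WeierstrassCurve ℚ) [W.IsElliptic] [W.IsGloballyMinimal] (p : ℕ) [Fact p.Prime],
        p ≠ 2 → ¬ W.HasGoodReductionAtPrime p → ¬ W.HasMultiplicativeReductionAtPrime p →
        0 ≤ padicValRat p W.j → ¬ W.HasIrreducibleModPGaloisRep p →
        W.entireLFunction 1 ≠ 0 → Finite W.sha →
        ∃ (W' : WeierstrassCurve ℚ) (_ : W'.IsElliptic) (_ : W'.IsGloballyMinimal),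
          IsIsogenous W W' ∧ Finite W'.sha ∧
          ∃ q : ℚ, W'.entireLFunction 1 / (W'.realPeriodRat : ℂ) = (q : ℂ) ∧
            (padicValNat p (Nat.card (AddCommGroup.primaryComponent W'.sha p)) : ℤ) +
                padicValNat p W'.tamagawaProduct ≤
              padicValRat p q + 2 * (padicValNat p W'.torsionOrder : ℤ))) :
    ∃ IsHullOf : (∀ (W : WeierstrassCurve ℚ) [W.IsElliptic] [W.IsGloballyMinimal] (p : ℕ)
        [Fact p.Prime], KatoHullDescentDatum p → Prop),
      KatoHull.MemberRealizable IsHullOf ∧ KatoHull.DivisibilityReading IsHullOf ∧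
        KatoHull.ExactCountReading IsHullOf := by
  refine ⟨fun W _ _ p _ D =>
      D.HullDivisibility ∧ Finite (coinvariants p D.H2) ∧ D.yIndex ≠ 0 ∧
        (W.entireLFunction 1 ≠ 0 → Finite W.sha →
          ∃ q : ℚ, W.entireLFunction 1 / (W.realPeriodRat : ℂ) = (q : ℂ) ∧
            (padicValNat p (Nat.card (AddCommGroup.primaryComponent W.sha p)) : ℤ) +
                padicValNat p W.tamagawaProduct + padicValNat p D.yIndex =
              padicValRat p q + D.e + padicValNat p D.h2Card +
                2 * (padicValNat p W.torsionOrder : ℤ)),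
    ?_, fun _W _ _ _p _ _D _ _ _ _ hD => hD.1,
    fun _W _ _ _p _ _D _ _ _ hL hfin hD => ⟨hD.2.1, hD.2.2.1, hD.2.2.2 hL hfin⟩⟩
  intro W _ _ p _ hp hadd hj hred
  have hprime := (Fact.out : p.Prime)
  -- the datum with `[A : y] = p^a` realises the predicate at any curve whose `2t`-defect is `a`
  have key : ∀ (V : WeierstrassCurve ℚ) [V.IsElliptic] [V.IsGloballyMinimal] (a : ℕ),
      (V.entireLFunction 1 ≠ 0 → Finite V.sha →
        ∃ q : ℚ, V.entireLFunction 1 / (V.realPeriodRat : ℂ) = (q : ℂ) ∧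
          (padicValNat p (Nat.card (AddCommGroup.primaryComponent V.sha p)) : ℤ) +
              padicValNat p V.tamagawaProduct + a =
            padicValRat p q + 2 * (padicValNat p V.torsionOrder : ℤ)) →
      ∃ D : KatoHullDescentDatum p,
        D.HullDivisibility ∧ Finite (coinvariants p D.H2) ∧ D.yIndex ≠ 0 ∧
        (V.entireLFunction 1 ≠ 0 → Finite V.sha →
          ∃ q : ℚ, V.entireLFunction 1 / (V.realPeriodRat : ℂ) = (q : ℂ) ∧
            (padicValNat p (Nat.card (AddCommGroup.primaryComponent V.sha p)) : ℤ) +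
                padicValNat p V.tamagawaProduct + padicValNat p D.yIndex =
              padicValRat p q + D.e + padicValNat p D.h2Card +
                2 * (padicValNat p V.torsionOrder : ℤ)) := by
    intro V _ _ a h
    obtain ⟨D, hdiv, hfin2, hy, hh2, he⟩ := exists_hullDatum_yIndex_eq_pow p a
    refine ⟨D, hdiv, hfin2, by rw [hy]; exact pow_ne_zero _ hprime.ne_zero, fun hL hfin => ?_⟩
    obtain ⟨q, hq, heq⟩ := h hL hfin
    refine ⟨q, hq, ?_⟩
    rw [hy, hh2, he, padicValNat.prime_pow, padicValNat_one_right]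
    simp only [Nat.cast_zero, add_zero]
    linarith
  by_cases hL : W.entireLFunction 1 ≠ 0
  · by_cases hfin : Finite W.sha
    · obtain ⟨W', hE', hM', hiso, _, q, hq, hle⟩ := hK W p hp hadd.1 hadd.2 hj hred hL hfin
      -- the defect `a ≥ 0`
      obtain ⟨a, ha⟩ := Int.eq_ofNat_of_zero_le (sub_nonneg.mpr hle)
      obtain ⟨D, hD⟩ := key W' a fun _ _ => ⟨q, hq, by linarith⟩
      exact ⟨W', hE', hM', hiso, D, hD⟩
    · obtain ⟨D, hD⟩ := key W 0 fun _ h => absurd h hfin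
      exact ⟨W, inferInstance, inferInstance, isIsogenous_self W, D, hD⟩
  · obtain ⟨D, hD⟩ := key W 0 fun h _ => absurd h hL
    exact ⟨W, inferInstance, inferInstance, isIsogenous_self W, D, hD⟩

/-- **TIGHTNESS of the SHARP hull readings.** The `2t` member bound (the BSD_p-exact upper half at SOME
member of every reducible additive potentially-good rank-0 class) holds IF AND ONLY IF there is SOME
interface predicate over which M1 `KatoHull.MemberRealizable`, M2 `KatoHull.DivisibilityReading` and the
EXACT count M3♯ `KatoHull.ExactCountReading` hold. So even the exact-count readings, existentially closed
over the free predicate, carry no more than their conclusion: they settle nothing by citation until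
`IsHullOf` is PINNED to Kato's objects. [folklore] -/
theorem two_iff_exists_hullReadingsSharp :
    (∀ (W : WeierstrassCurve ℚ) [W.IsElliptic] [W.IsGloballyMinimal] (p : ℕ) [Fact p.Prime],
        p ≠ 2 → ¬ W.HasGoodReductionAtPrime p → ¬ W.HasMultiplicativeReductionAtPrime p →
        0 ≤ padicValRat p W.j → ¬ W.HasIrreducibleModPGaloisRep p →
        W.entireLFunction 1 ≠ 0 → Finite W.sha →
        ∃ (W' : WeierstrassCurve ℚ) (_ : W'.IsElliptic) (_ : W'.IsGloballyMinimal),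
          IsIsogenous W W' ∧ Finite W'.sha ∧
          ∃ q : ℚ, W'.entireLFunction 1 / (W'.realPeriodRat : ℂ) = (q : ℂ) ∧
            (padicValNat p (Nat.card (AddCommGroup.primaryComponent W'.sha p)) : ℤ) +
                padicValNat p W'.tamagawaProduct ≤
              padicValRat p q + 2 * (padicValNat p W'.torsionOrder : ℤ)) ↔
      ∃ IsHullOf : (∀ (W : WeierstrassCurve ℚ) [W.IsElliptic] [W.IsGloballyMinimal] (p : ℕ)
          [Fact p.Prime], KatoHullDescentDatum p → Prop),
        KatoHull.MemberRealizable IsHullOf ∧ KatoHull.DivisibilityReading IsHullOf ∧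
          KatoHull.ExactCountReading IsHullOf :=
  ⟨exists_hullReadingsSharp_of_two, fun ⟨_, hM, hD, hC⟩ => two_of_hullReadingsSharp hM hD hC⟩

/-- In particular the sharp readings are at least as strong as the node `O6.KatoMemberShaBoundOfReducible`
(crux `ReducibleKatoMember`): `2t ≤ 3t`. [folklore] -/
theorem of_two (hK : (∀ (W : WeierstrassCurve ℚ) [W.IsElliptic] [W.IsGloballyMinimal] (p : ℕ) [Fact p.Prime],
        p ≠ 2 → ¬ W.HasGoodReductionAtPrime p → ¬ W.HasMultiplicativeReductionAtPrime p →
        0 ≤ padicValRat p W.j → ¬ W.HasIrreducibleModPGaloisRep p →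
        W.entireLFunction 1 ≠ 0 → Finite W.sha →
        ∃ (W' : WeierstrassCurve ℚ) (_ : W'.IsElliptic) (_ : W'.IsGloballyMinimal),
          IsIsogenous W W' ∧ Finite W'.sha ∧
          ∃ q : ℚ, W'.entireLFunction 1 / (W'.realPeriodRat : ℂ) = (q : ℂ) ∧
            (padicValNat p (Nat.card (AddCommGroup.primaryComponent W'.sha p)) : ℤ) +
                padicValNat p W'.tamagawaProduct ≤
              padicValRat p q + 2 * (padicValNat p W'.torsionOrder : ℤ))) : O6.KatoMemberShaBoundOfReducible := by
  intro W _ _ p _ hp hng hnm hj hred hL hfin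
  obtain ⟨W', hE', hM', hiso, hfin', q, hq, hle⟩ := hK W p hp hng hnm hj hred hL hfin
  exact ⟨W', hE', hM', hiso, hfin', q, hq, by linarith [padicValNat p W'.torsionOrder]⟩


end O6.KatoMemberShaBoundOfReducible

end Summit.BirchSwinnertonDyer.Rank1Residual

end
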